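import Summits.NavierStokesRegularity.NavierStokesRegularity.Theorems.CertifiedBlowupCertifiedBlowupAxisymBlowupSwirlPersists
import Summits.NavierStokesRegularity.NavierStokesRegularity.Theorems.PlaneEnergyCeilingPlanarEnergyAPrioriAxisymCorner
import Summits.NavierStokesRegularity.NavierStokesRegularity.Theorems.CertifiedBlowupCertifiedBlowupAxisymBlowupBKM
import Summits.NavierStokesRegularity.NavierStokesRegularity.Theorems.ScaledTopAlignmentGigaMiuraDirectionGradientHolds
import Summits.NavierStokesRegularity.NavierStokesRegularity.Theorems.ScaledTopAlignmentGigaMiuraDirectionGradientLaLbHolds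
import Summits.NavierStokesRegularity.NavierStokesRegularity.Theorems.SymmetryModuliCountLiouvilleKillsTypeI
import Literature.Analysis.FluidPDE.ConstantinFeffermanHolds
import Literature.Analysis.FluidPDE.HolderHalfDirectionCriterion
import Summits.NavierStokesRegularity.NavierStokesRegularity.Theorems.L3TimeExponentPincerWeakL3Morrey
import Summits.NavierStokesRegularity.NavierStokesRegularity.Theorems.ScenarioCensusForward
import Summits.NavierStokesRegularity.NavierStokesRegularity.Theorems.ScenarioCensusAncient
import HarnessLib.Audit
import HarnessLib

/-!
# Blow-up scenario census — block F, the axisymmetric rows in the census frame (F2c, F3c)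

Annex of block F of the cell `pub/ns-census` census (`SCENARIO-CENSUS.md` v1.8, refuter findings H5,
H6).  Rows F2 (axisymmetric Type I, KNSS 2009 / Seregin–Šverák 2009) and F3 (axisymmetric without
swirl, Ladyzhenskaya / Ukhovskii–Yudovich 1968) are EXCLUDED-IN-TREE in `ScenarioCensusForward.lean`
in the classes of the Literature closers (`knss_no_axisymmetric_typeI_holds`: boundedness on closed
sub-strips and axisymmetry of every slice as hypotheses; `axisymmetric_no_swirl_global_regularity_holds`:
a global solution from the datum).  This file types the same two cells in the census's own FORWARD
FRAME — `ν, T > 0`, `(u, p)` classical on `ℝ³ × [0,T)`, Leray–Hopf from its RAPIDLY DECAYING datum,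
symmetry imposed on the DATUM only, conclusion `HasSmoothExtensionPast ν 0 u T` — where the extra
hypotheses are discharged by tree theorems living in route cones (hence this separate file, which
knowingly carries the theses-cone warning; the main census files stay route-independent):

| key | cell | value / Lean |
|---|---|---|
| F2c | axisymmetric datum · Type I at `T` OR the axis bound `r‖u‖ ≤ C` on `[0,T)` · census frame | EXCLUDED-IN-TREE — `Row_F2c` / `STH.CertifiedBlowupAxisymBlowup.CompactAmplification.hasSmoothExtensionPast_of_typeI_or_axisBound` (slice axisymmetry and sub-strip bounds discharged there) |
| F3c | axisymmetric swirl-free datum · any type · census frame | EXCLUDED-IN-TREE — `Row_F3c` / `STH.PlanarEnergyAPriori.hasSmoothExtensionPast_of_axisymmetric_noSwirl` (Sobolev-class uniqueness against the global Ladyzhenskaya–Ukhovskii–Yudovich solution) |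

**Nothing here is a claim about Navier–Stokes regularity beyond the cited tree theorems; no summit
statement is proved by this seat.**  `STH.` = `Summit.NavierStokesRegularity.NavierStokesRegularity.Theorems.`.
-/

noncomputable section

-- the summit and its single problem share the name `NavierStokesRegularity` (D-0017 nested layout)
set_option linter.dupNamespace false

open Set Function Filter Topology MeasureTheory

namespace Summit.NavierStokesRegularity.NavierStokesRegularity.Theorems.ScenarioCensus

open Literature.Analysis Literature.Analysis.FluidPDE

/-- **Row F2c** (Type I — or the scale-critical axis bound — · axisymmetric DATUM, swirl allowed ·
census frame): for `ν, T > 0`, a classical solution `(u, p)` of the unforced Navier–Stokes system on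
`ℝ³ × [0,T)`, Leray–Hopf from its rapidly decaying axisymmetric datum `u(0)`, which is either of
Type I at `T` (`IsTypeIBlowup u T`: `‖u(t,x)‖ ≤ C/√(T−t)` eventually) or obeys `r ‖u(t,x)‖ ≤ C` on
`[0,T) × ℝ³` (`r` = distance to the axis), extends to a classical solution past `T`.  KNSS 2009
Thms 6.1–6.2 / Seregin–Šverák 2009 in the tree (`knss_no_axisymmetric_typeI_holds`, row F2), with the
boundedness-on-sub-strips and slice-axisymmetry hypotheses of that closer DISCHARGED from the frame
(`bounded_before_of_lerayHopf_classical`, `isAxisymmetric_slice_of_lerayHopf_classical`): the statement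
of `CertifiedBlowupAxisymBlowup.CompactAmplification.hasSmoothExtensionPast_of_typeI_or_axisBound`.
EXCLUDED-IN-TREE. (ref: KochNadirashviliSereginSverak2009, Thms 6.1–6.2; SereginSverak2009, Thm 1.1) -/
def Row_F2c : Prop :=
  ∀ (ν T : ℝ), 0 < ν → 0 < T →
    ∀ (u : ℝ → EuclideanSpace ℝ (Fin 3) → EuclideanSpace ℝ (Fin 3))
      (p : ℝ → EuclideanSpace ℝ (Fin 3) → ℝ),
    IsClassicalNSSolutionOn (Ico 0 T) ν 0 u p → IsLerayHopfOn T ν 0 (u 0) u →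
    HasRapidSpatialDecay (u 0) → IsAxisymmetric (u 0) →
    (IsTypeIBlowup u T ∨ ∃ C : ℝ, ∀ t ∈ Ico 0 T, ∀ x, cylRadius x * ‖u t x‖ ≤ C) →
    HasSmoothExtensionPast ν 0 u T

/-- Row F2c is a theorem of the tree. [cite: KochNadirashviliSereginSverak2009, Thms 6.1–6.2] -/
theorem row_F2c_excluded : Row_F2c := fun _ _ hν hT _ _ hcl hLH hdec haxi h =>
  CertifiedBlowupAxisymBlowup.CompactAmplification.hasSmoothExtensionPast_of_typeI_or_axisBound
    hν hT hcl hLH hdec haxi h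

/-- **Row F3c** (any type · axisymmetric SWIRL-FREE datum · census frame): for `ν, T > 0`, a classical
solution `(u, p)` on `ℝ³ × [0,T)`, Leray–Hopf from its rapidly decaying datum `u(0)` which is
axisymmetric without swirl, extends to a classical solution past `T` — it is the restriction of the
global Ladyzhenskaya–Ukhovskii–Yudovich solution (row F3, `axisymmetric_no_swirl_global_regularity_holds`)
by Sobolev-class uniqueness on closed slabs: the statement of
`PlanarEnergyAPriori.hasSmoothExtensionPast_of_axisymmetric_noSwirl`.  EXCLUDED-IN-TREE.
(ref: Ladyzhenskaya1968 / UkhovskiiYudovich1968; LemarieRieusset2016, Thm 10.4) -/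
def Row_F3c : Prop :=
  ∀ (ν T : ℝ), 0 < ν → 0 < T →
    ∀ (u : ℝ → EuclideanSpace ℝ (Fin 3) → EuclideanSpace ℝ (Fin 3))
      (p : ℝ → EuclideanSpace ℝ (Fin 3) → ℝ),
    IsClassicalNSSolutionOn (Ico 0 T) ν 0 u p → IsLerayHopfOn T ν 0 (u 0) u →
    HasRapidSpatialDecay (u 0) → IsAxisymmetric (u 0) → HasNoSwirl (u 0) →
    HasSmoothExtensionPast ν 0 u T

/-- Row F3c is a theorem of the tree. [folklore] -/
theorem row_F3c_excluded : Row_F3c := fun _ _ hν hT _ _ hcl hLH hdec haxi hsw =>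
  PlanarEnergyAPriori.hasSmoothExtensionPast_of_axisymmetric_noSwirl hν hT hcl hLH hdec haxi hsw

/-! ## Rows F18 (census frame) and F1b′ (appended 2026-08-28; census v1.9 keys, ref H14 / probe P12)

The vorticity-direction COHERENCE criteria are printed (and typed in `Literature/`) in the
Beale–Kato–Majda class on closed sub-slabs; in the census frame that class is DISCHARGED by
`STH.CertifiedBlowupAxisymBlowup.CompactAmplification.hasBoundedSobolevNormsOn_before_of_lerayHopf_classical`
(classical on `[0,T)` + Leray–Hopf + rapidly decaying datum ⇒ BKM class on every `[0,T'']`, `T'' < T`),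
and the BKM continuation upgrades to a classical one (`HasSobolevExtensionPast.hasSmoothExtensionPast`).
The two corollaries below are the census refuter's probe `P12.lean` (`CensusProbeP12.cf_census`,
`bdvb_census`), landed here with credit.  Row F1b′'s closers live in the `ScaledTopAlignment` cone. -/

open scoped RealInnerProductSpace ENNReal NNReal

/-- **Row F18, census frame, Constantin–Fefferman** (I∨II · none · census frame · the vorticity
direction is Lipschitz-coherent with length `ρ` where `|ω| > Ω`: for all `t ∈ [0,T)` and all `x, y`
with `‖ω(t,x)‖, ‖ω(t,y)‖ > Ω`, `|sin∠(ξ(t,x), ξ(t,y))| ≤ ‖x − y‖/ρ`) ⇒ extension past `T`.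
Constantin–Fefferman 1993 (`constantin_fefferman_holds`) with the BKM class discharged from the frame.
EXCLUDED-IN-TREE (`row_F18cf_excluded`; = ref probe `CensusProbeP12.cf_census`).
(ref: ConstantinFefferman1993, Theorem; LemarieRieusset2016, Thm 11.6) -/
def Row_F18cf : Prop :=
  ∀ (ν T Ω ρ : ℝ), 0 < ν → 0 < T → 0 < Ω → 0 < ρ →
    ∀ (u : ℝ → EuclideanSpace ℝ (Fin 3) → EuclideanSpace ℝ (Fin 3))
      (p : ℝ → EuclideanSpace ℝ (Fin 3) → ℝ),
    IsClassicalNSSolutionOn (Ico 0 T) ν 0 u p → IsLerayHopfOn T ν 0 (u 0) u →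
    HasRapidSpatialDecay (u 0) →
    (∀ t ∈ Ico 0 T, ∀ x y : EuclideanSpace ℝ (Fin 3), Ω < ‖curl (u t) x‖ → Ω < ‖curl (u t) y‖ →
      Real.sqrt (1 - ⟪vorticityDirection (curl (u t)) x, vorticityDirection (curl (u t)) y⟫ ^ 2) ≤
        ‖x - y‖ / ρ) →
    HasSmoothExtensionPast ν 0 u T

/-- Row F18 (census frame, CF) is a theorem of the tree (adapted from the refuter's probe P12).
[cite: ConstantinFefferman1993, Theorem] -/
theorem row_F18cf_excluded : Row_F18cf := fun _ _ _ _ hν hT hΩ hρ _ _ hcl hLH hdec hdir =>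
  (constantin_fefferman_holds hν hT hΩ hρ hcl
    (CertifiedBlowupAxisymBlowup.CompactAmplification.hasBoundedSobolevNormsOn_before_of_lerayHopf_classical
      hν hT hcl hLH hdec) hdir).hasSmoothExtensionPast

/-- **Row F18, census frame, Hölder coherence `α ≥ ½`** (Beirão da Veiga–Berselli 2002 Thm 1.2,
Assumption A; census frame · `|sin∠(ξ(t,x), ξ(t,y))| ≤ M ‖x − y‖^α` where `|ω| > Ω`, some `α ≥ ½`)
⇒ extension past `T`: `holder_direction_criterion` with the BKM class discharged from the frame.
EXCLUDED-IN-TREE (`row_F18h_excluded`; = ref probe `CensusProbeP12.bdvb_census`).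
(ref: BeiraodaveigaBerselli2002, Thm 1.2; LemarieRieusset2016, Thm 11.7) -/
def Row_F18h : Prop :=
  ∀ (ν T Ω M α : ℝ), 0 < ν → 0 < T → 0 < Ω → 1 / 2 ≤ α →
    ∀ (u : ℝ → EuclideanSpace ℝ (Fin 3) → EuclideanSpace ℝ (Fin 3))
      (p : ℝ → EuclideanSpace ℝ (Fin 3) → ℝ),
    IsClassicalNSSolutionOn (Ico 0 T) ν 0 u p → IsLerayHopfOn T ν 0 (u 0) u →
    HasRapidSpatialDecay (u 0) →
    (∀ t ∈ Ico 0 T, ∀ x y : EuclideanSpace ℝ (Fin 3), Ω < ‖curl (u t) x‖ → Ω < ‖curl (u t) y‖ →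
      Real.sqrt (1 - ⟪vorticityDirection (curl (u t)) x, vorticityDirection (curl (u t)) y⟫ ^ 2) ≤
        M * ‖x - y‖ ^ α) →
    HasSmoothExtensionPast ν 0 u T

/-- Row F18 (census frame, Hölder `α ≥ ½`) is a theorem of the tree (adapted from the refuter's probe
P12). [cite: BeiraodaveigaBerselli2002, Thm. 1.2 (Assumption A)] -/
theorem row_F18h_excluded : Row_F18h := fun _ _ _ _ _ hν hT hΩ hα _ _ hcl hLH hdec hdir =>
  (holder_direction_criterion hν hT hΩ hα hcl
    (CertifiedBlowupAxisymBlowup.CompactAmplification.hasBoundedSobolevNormsOn_before_of_lerayHopf_classical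
      hν hT hcl hLH hdec) hdir).hasSmoothExtensionPast

/-- **Row F1b′** (Type I · none · the Giga–Miura direction-GRADIENT classes: `∇ξ` square-integrable in
time of its sup over `{|ω| > d}` (Cor. 2.6), or `∇ξ ∈ L^a_t L^b_x({|ω| > d})`, `2/a + 3/b = 1`,
`3 < b < ∞` (Rmk. 2.8); classical Leray–Hopf solution bounded on closed sub-strips, Type I at `T`) ⇒
extension past `T` — ALIAS of the conjunction of the two typed facts
`gigaMiura2011_directionGradient_typeI` / `…_LaLb_typeI`, DISCHARGED in tree by
`STH.gigaMiura2011_directionGradient_typeI_holds` / `…_LaLb_typeI_holds` (route `ScaledTopAlignment`).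
EXCLUDED-IN-TREE (criteria; census-frame form with the sub-strip bound discharged: `Row_F1bpc`).
(ref: GigaMiura2011, Cor. 2.6, Rmk. 2.7–2.8) -/
def Row_F1bp : Prop :=
  gigaMiura2011_directionGradient_typeI ∧ gigaMiura2011_directionGradient_LaLb_typeI

/-- Row F1b′ is a theorem of the tree (two discharges). [cite: GigaMiura2011, Cor. 2.6 with Rmk. 2.7] -/
theorem row_F1bp_excluded : Row_F1bp :=
  ⟨Theorems.gigaMiura2011_directionGradient_typeI_holds, Theorems.gigaMiura2011_directionGradient_LaLb_typeI_holds⟩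

/-- **Row F1b′, census frame** (Type I at `T` · none · census frame · for some `d > 0` a function
`g ∈ L²(0,T)` dominating `‖∇ξ(t,x)‖` wherever `‖ω(t,x)‖ > d`) ⇒ extension past `T`: Giga–Miura 2011
Cor. 2.6 with the boundedness on closed sub-strips DISCHARGED from the frame
(`liouvilleKillsTypeI_exists_bound_Icc`: Tao's `H^k` theory + `H² ⊂ C_b`).  EXCLUDED-IN-TREE.
(ref: GigaMiura2011, Cor. 2.6) -/
def Row_F1bpc : Prop :=
  ∀ (ν T : ℝ), 0 < ν → 0 < T →
    ∀ (u : ℝ → EuclideanSpace ℝ (Fin 3) → EuclideanSpace ℝ (Fin 3))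
      (p : ℝ → EuclideanSpace ℝ (Fin 3) → ℝ),
    IsClassicalNSSolutionOn (Ico 0 T) ν 0 u p → IsLerayHopfOn T ν 0 (u 0) u →
    HasRapidSpatialDecay (u 0) → IsTypeIBlowup u T →
    (∃ d : ℝ, 0 < d ∧ ∃ g : ℝ → ℝ≥0∞, Measurable g ∧ (∫⁻ t in Ioo 0 T, g t ^ 2) < ⊤ ∧
      ∀ t ∈ Ioo 0 T, ∀ x : EuclideanSpace ℝ (Fin 3), d < ‖curl (u t) x‖ →
        ‖fderiv ℝ (vorticityDirection (curl (u t))) x‖ₑ ≤ g t) →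
    HasSmoothExtensionPast ν 0 u T

/-- Row F1b′ (census frame) is a theorem of the tree. [cite: GigaMiura2011, Cor. 2.6] -/
theorem row_F1bpc_excluded : Row_F1bpc := by
  intro ν T hν hT u p hcl hLH hdec hI hD
  have hbdd : ∀ T' < T, ∃ M : ℝ, ∀ t ∈ Icc 0 T', ∀ x, ‖u t x‖ ≤ M := by
    intro T' hT'
    by_cases h : 0 < T'
    · exact Theorems.liouvilleKillsTypeI_exists_bound_Icc hν hcl hLH hdec ⟨h, hT'⟩
    · obtain ⟨M, hM⟩ := Theorems.liouvilleKillsTypeI_exists_bound_Icc hν hcl hLH hdec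
        (T' := T / 2) ⟨by linarith, by linarith⟩
      push Not at h
      exact ⟨M, fun s hs x => hM s ⟨hs.1, by linarith [hs.2]⟩ x⟩
  exact Theorems.gigaMiura2011_directionGradient_typeI_holds hν hT hcl hLH hbdd hI hD

/-! ## Row F7 ⇐ Row F6b (appended 2026-08-28; refuter H7) -/

open Literature.Analysis.FunctionSpaces in
/-- **Weak-`L³` level sets under the viscosity rescaling.** If the rescaled slice
`ũ(νt) = ν⁻¹ u(t)` (`timeRescale ν⁻¹ ν⁻¹ u`) has weak-`L³` quasi-norm `sup_r r³ |{r < |ũ|}| ≤ W < ∞`,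
then every level set of `u(t)` obeys `s³ |{s < |u(t)|}| ≤ ν³ W` (`s > 0`): the level `r = ν⁻¹ s` of
`ũ(νt)` is the level `s` of `u(t)`.  Converts row F7's hypothesis into the distribution-function form
used by `L3TimeExponentPincerWeakL3Morrey`. [folklore] -/
theorem weakL3_levelSet_le_of_timeRescale {ν t s : ℝ} (hν : 0 < ν) (hs : 0 < s)
    {u : ℝ → EuclideanSpace ℝ (Fin 3) → EuclideanSpace ℝ (Fin 3)} {W : ℝ≥0∞} (hW : W ≠ ⊤)
    (hle : eWeakLpPow (timeRescale ν⁻¹ ν⁻¹ u (ν * t)) 3 volume ≤ W) :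
    ENNReal.ofReal s ^ 3 * volume {x | s < ‖u t x‖} ≤ ENNReal.ofReal (ν ^ 3 * W.toReal) := by
  have hνinv : 0 < ν⁻¹ := inv_pos.2 hν
  -- the level set of the rescaled slice at height `ν⁻¹ s` is the level set of `u t` at height `s`
  have hset : {x | (((ν⁻¹ * s).toNNReal : ℝ≥0) : ℝ≥0∞) <
      ‖timeRescale ν⁻¹ ν⁻¹ u (ν * t) x‖ₑ} = {x | s < ‖u t x‖} := by
    ext x
    simp only [mem_setOf_eq, timeRescale_apply]
    have htt : ν⁻¹ * (ν * t) = t := by field_simp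
    rw [htt, enorm_smul, show (((ν⁻¹ * s).toNNReal : ℝ≥0) : ℝ≥0∞) = ENNReal.ofReal (ν⁻¹ * s) from rfl,
      Real.enorm_eq_ofReal hνinv.le, ← ofReal_norm, ← ENNReal.ofReal_mul hνinv.le,
      ENNReal.ofReal_lt_ofReal_iff']
    constructor
    · rintro ⟨h1, -⟩; exact lt_of_mul_lt_mul_left h1 hνinv.le
    · intro h; exact ⟨mul_lt_mul_of_pos_left h hνinv, mul_pos hνinv (hs.trans h)⟩
  -- specialise the supremum defining `eWeakLpPow` at the level `ν⁻¹ s`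
  have hsup : (((ν⁻¹ * s).toNNReal : ℝ≥0) : ℝ≥0∞) ^ (3 : ℝ≥0∞).toReal *
      volume {x | (((ν⁻¹ * s).toNNReal : ℝ≥0) : ℝ≥0∞) <
        ‖timeRescale ν⁻¹ ν⁻¹ u (ν * t) x‖ₑ} ≤ W := by
    refine le_trans ?_ hle
    exact le_iSup (fun r : ℝ≥0 => (r : ℝ≥0∞) ^ (3 : ℝ≥0∞).toReal *
      volume {x | (r : ℝ≥0∞) < ‖timeRescale ν⁻¹ ν⁻¹ u (ν * t) x‖ₑ}) (ν⁻¹ * s).toNNReal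
  rw [hset] at hsup
  have hcoe : (((ν⁻¹ * s).toNNReal : ℝ≥0) : ℝ≥0∞) = ENNReal.ofReal (ν⁻¹ * s) := by
    rw [ENNReal.ofReal, Real.toNNReal_of_nonneg (by positivity)]
  have h3 : (3 : ℝ≥0∞).toReal = ((3 : ℕ) : ℝ) := by norm_num
  rw [hcoe, h3, ENNReal.rpow_natCast] at hsup
  -- `ofReal s ^ 3 = ofReal ν ^ 3 * ofReal (ν⁻¹ s) ^ 3`
  have hsplit : ENNReal.ofReal s = ENNReal.ofReal ν * ENNReal.ofReal (ν⁻¹ * s) := by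
    rw [← ENNReal.ofReal_mul hν.le]; congr 1; field_simp
  calc ENNReal.ofReal s ^ 3 * volume {x | s < ‖u t x‖}
      = ENNReal.ofReal ν ^ 3 * (ENNReal.ofReal (ν⁻¹ * s) ^ 3 * volume {x | s < ‖u t x‖}) := by
        rw [hsplit, mul_pow, mul_assoc]
    _ ≤ ENNReal.ofReal ν ^ 3 * W := by gcongr
    _ = ENNReal.ofReal (ν ^ 3 * W.toReal) := by
        rw [ENNReal.ofReal_mul (by positivity), ENNReal.ofReal_pow hν.le, ENNReal.ofReal_toReal hW]

open Literature.Analysis.FunctionSpaces in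
/-- **Row F7 ⇐ Row F6b** (refuter H7; census F7 note «implied IN TREE by ⟨19500⟩»): the supercritical
Serrin-`L³` statement `Row_F6b` (= item ⟨19500⟩ `THS.L3TimeExponentPincer.SupercriticalSerrinL3`
verbatim) implies continuation for census-frame solutions whose late viscosity-normalised slices are
uniformly bounded in weak-`L³`, with NO smallness — via
`STH.L3TimeExponentPincerWeakL3Morrey.hasSmoothExtensionPast_of_weakL3_of_supercriticalSerrinL3`
(weak-`L³` ⇒ full Morrey Type-I near `T` ⇒ the jaw), after undoing the time rescaling
(`T₁ = S₁/ν`, `M = ν³ W`).  Both rows are OPEN; this is a glue between census rows. [folklore] -/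
theorem row_F7_of_row_F6b (h6 : Row_F6b) : Row_F7 := by
  intro ν T hν hT u p hcl hLH hdec S₁ W hS₁ hS₁T hW hweak
  have hT₁0 : 0 ≤ S₁ / ν := div_nonneg hS₁ hν.le
  have hT₁ : S₁ / ν < T := by rw [div_lt_iff₀ hν]; linarith [mul_comm ν T]
  have hM : 0 ≤ ν ^ 3 * W.toReal := by positivity
  refine L3TimeExponentPincerWeakL3Morrey.hasSmoothExtensionPast_of_weakL3_of_supercriticalSerrinL3
    h6 hν hT hcl hLH hdec hT₁0 hT₁ hM ?_
  intro t ht s hs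
  have hνt : ν * t ∈ Ioo S₁ (ν * T) := by
    constructor
    · have h1 := ht.1
      rw [div_lt_iff₀ hν] at h1
      linarith [mul_comm t ν]
    · exact mul_lt_mul_of_pos_left ht.2 hν
  exact weakL3_levelSet_le_of_timeRescale hν hs hW (hweak (ν * t) hνt)

/-! ## Row F1e ↔ Row A2 (appended 2026-08-28; census §6 ask `row_F1e_iff_row_A2`) -/

/-- **F1e ⇔ A2 (Albritton–Barker 2019 Thm 1.1).** The forward cell F1e («no LOCAL Type-I singularity»,
`Row_F1e := ¬ LocalTypeISingularityExists`, block F) and the ancient cell A2 («no nontrivial mild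
bounded ancient solution with Type-I decay», typer-2's `Row_A2 := ¬ NontrivialMildAncientTypeIExists`,
block A) are the SAME cell: `AlbrittonBarkerTypeICharacterization_holds`, through typer-2's
`row_A2_iff_not_localTypeISingularityExists`.  (This file already sits in several route cones, so the
block-A import is harmless here; the cone-free block files stay unlinked.)
[cite: AlbrittonBarker2019, Thm 1.1] -/
theorem row_F1e_iff_row_A2 : Row_F1e ↔ Row_A2 :=
  row_A2_iff_not_localTypeISingularityExists.symm

end Summit.NavierStokesRegularity.NavierStokesRegularity.Theorems.ScenarioCensus

end
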